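import Literature.Analysis.FluidPDE.FourierL2Nonlin
import Literature.Analysis.FluidPDE.NSFourierPicard
import Mathlib.Analysis.SpecialFunctions.Pow.Continuity
import Mathlib.MeasureTheory.Integral.Lebesgue.DominatedConvergence
import HarnessLib

/-!
# `L²`-continuous Fourier trajectories: continuity of the nonlinearity and of the Duhamel map

Fifth file of the weighted-`L²` Fourier-side construction of the local smooth solution of the
Navier–Stokes system with `H¹`-controlled lifespan (discharge of
`Literature.Analysis.FluidPDE.tao2011_fourier_local_existence`; Tao 2013, Thm. 5.4 (ii)+(iv)).
The Picard iterates for a datum `a` of Sobolev class are trajectories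
`v(t) = e^{-c‖ξ‖² clamp(t)} a - D(t)` whose *heat part* is only weighted square integrable in
the frequency (not continuous), while the *Duhamel part* `D` is jointly continuous with pointwise
polynomial decay (`FourierNS.HasDecay`). The tree's continuity statements for the Duhamel map
(`NSFourierPicard`: `continuous_duhamel`, …) assume joint continuity and pointwise decay of the
whole trajectory; here they are re-derived from **`L²`-continuity in time of the components**,
which both parts enjoy:

* `tendsto_eLpNorm_sub_of_dominated`: a pointwise-continuous family with a square-integrable
  dominating function is continuous in `L²` (dominated convergence);
* `tendsto_eLpNorm_heat_sub`, `tendsto_eLpNorm_sub_of_hasDecay`: the heat part of a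
  square-integrable datum and a jointly continuous trajectory with uniform decay of order
  `K > dim/2` are `L²`-continuous, componentwise; `memLp_two_of_hasDecay_half` (`L²` membership);
* `continuous_nonlin_of_tendsto`: for trajectories `v`, `w` with square-integrable,
  `L²`-continuous components, `(s, ξ) ↦ N(v s, w s)(ξ)` is jointly continuous
  (`continuous_fconv_family` of `FourierL2Convolution`, componentwise), and likewise the pressure
  symbol (`continuous_presSymbol_of_tendsto`) and the real majorant convolution
  (`continuous_fconv_majorant_of_tendsto`);
* `lconv_majorant_eq_enorm_fconv`: the majorant convolution `(∑‖uⱼ‖ₑ) ⋆ₗ (∑‖u'ⱼ‖ₑ)` is the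
  norm of the convolution of the real majorants (bridge to Plancherel-based estimates);
* `continuous_duhamelIntegral_of_tendsto`: hence the Duhamel integral
  `∫₀^{clamp t} e^{-c‖ξ‖²(clamp t - s)} N(v s, v s)(ξ) ds` (`FourierNS.duhamelIntegral`) is jointly
  continuous in `(t, ξ)`.

## Mathlib search

`MeasureTheory.tendsto_lintegral_filter_of_dominated_convergence'`, `Filter.Tendsto.ennrpow_const`,
`intervalIntegral.continuous_parametric_intervalIntegral_of_continuous`. Tree: `heat`, `clamp`,
`duhamelIntegral`, `HasDecay` (`NSFourierPicard`, `NSFourierBilinear`).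

## References

* T. Tao, Anal. PDE 6 (2013) = arXiv:1108.1165, proof of Thm. 5.1/5.4 (arXiv pp. 16, 18).
  [Tao2011]
* P. G. Lemarié-Rieusset, *The Navier–Stokes problem in the 21st century*, CRC 2016, §8.5.
-/

noncomputable section

open MeasureTheory Real Set Filter Function
open scoped ENNReal NNReal
open _root_.Topology

namespace Literature.Analysis.FluidPDE.FourierNS

variable {ι : Type*} [Fintype ι]

/-! ### `L²`-continuity by dominated convergence -/

section L2Continuity

variable {X : Type*} [TopologicalSpace X] [FirstCountableTopology X]

/-- **`L²`-continuity from pointwise continuity and domination.** If `x ↦ G x η` is continuous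
for every `η`, each `G x` is measurable and `‖G x η‖ₑ ≤ b η` with `∫⁻ b² < ∞`, then
`x ↦ G x` is continuous in `L²`: `‖G x - G x₀‖_{L²} → 0` (dominated convergence for
`‖G x - G x₀‖ₑ² ≤ 4 b²`). [folklore] -/
theorem tendsto_eLpNorm_sub_of_dominated {G : X → EuclideanSpace ℝ ι → ℂ}
    (hGm : ∀ x, AEStronglyMeasurable (G x) volume) (b : EuclideanSpace ℝ ι → ℝ≥0∞)
    (hb : ∀ x η, ‖G x η‖ₑ ≤ b η) (hfin : ∫⁻ η, b η ^ 2 ≠ ⊤)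
    (hcont : ∀ η, Continuous fun x => G x η) (x₀ : X) :
    Tendsto (fun x => eLpNorm (G x - G x₀) 2 volume) (𝓝 x₀) (𝓝 0) := by
  have hlin : Tendsto (fun x => ∫⁻ η, ‖G x η - G x₀ η‖ₑ ^ 2) (𝓝 x₀)
      (𝓝 (∫⁻ _η : EuclideanSpace ℝ ι, (0 : ℝ≥0∞))) := by
    refine tendsto_lintegral_filter_of_dominated_convergence' (fun η => 4 * b η ^ 2)
      (Eventually.of_forall fun x => ((hGm x).sub (hGm x₀)).enorm.pow_const 2)
      (Eventually.of_forall fun x => Eventually.of_forall fun η => ?_) ?_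
      (Eventually.of_forall fun η => ?_)
    · calc ‖G x η - G x₀ η‖ₑ ^ 2 ≤ (‖G x η‖ₑ + ‖G x₀ η‖ₑ) ^ 2 := pow_le_pow_left' (enorm_sub_le) 2
        _ ≤ (b η + b η) ^ 2 := pow_le_pow_left' (add_le_add (hb x η) (hb x₀ η)) 2
        _ = 4 * b η ^ 2 := by ring
    · rw [lintegral_const_mul' _ _ (by norm_num)]
      exact ENNReal.mul_ne_top (by norm_num) hfin
    · have h1 : Tendsto (fun x => G x η - G x₀ η) (𝓝 x₀) (𝓝 0) := by
        have hc' : Continuous fun x => G x η - G x₀ η := (hcont η).sub continuous_const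
        simpa using hc'.tendsto x₀
      have h2 : Tendsto (fun x => ‖G x η - G x₀ η‖ₑ) (𝓝 x₀) (𝓝 0) := by
        have := h1.enorm
        simpa using this
      have h3 : Tendsto (fun x => ‖G x η - G x₀ η‖ₑ ^ 2) (𝓝 x₀) (𝓝 (0 ^ 2)) :=
        ENNReal.Tendsto.pow h2
      simpa using h3
  rw [lintegral_zero] at hlin
  have h := hlin.ennrpow_const (1 / 2 : ℝ)
  rw [ENNReal.zero_rpow_of_pos (by norm_num)] at h
  refine h.congr fun x => ?_
  rw [lintegral_enorm_sq_rpow_half_eq_eLpNorm]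
  rfl

omit [FirstCountableTopology X] in
/-- `L²`-continuity of a difference of `L²`-continuous families. [folklore] -/
theorem tendsto_eLpNorm_sub_sub {F G : X → EuclideanSpace ℝ ι → ℂ}
    (hF : ∀ x, AEStronglyMeasurable (F x) volume) (hG : ∀ x, AEStronglyMeasurable (G x) volume)
    {x₀ : X} (hFc : Tendsto (fun x => eLpNorm (F x - F x₀) 2 volume) (𝓝 x₀) (𝓝 0))
    (hGc : Tendsto (fun x => eLpNorm (G x - G x₀) 2 volume) (𝓝 x₀) (𝓝 0)) :
    Tendsto (fun x => eLpNorm ((F x - G x) - (F x₀ - G x₀)) 2 volume) (𝓝 x₀) (𝓝 0) := by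
  refine tendsto_of_tendsto_of_tendsto_of_le_of_le tendsto_const_nhds
    (by simpa using hFc.add hGc) (fun x => zero_le) fun x => ?_
  calc eLpNorm ((F x - G x) - (F x₀ - G x₀)) 2 volume
      = eLpNorm ((F x - F x₀) - (G x - G x₀)) 2 volume := by congr 1; abel
    _ ≤ eLpNorm (F x - F x₀) 2 volume + eLpNorm (G x - G x₀) 2 volume :=
        eLpNorm_sub_le ((hF x).sub (hF x₀)) ((hG x).sub (hG x₀)) one_le_two

end L2Continuity

/-! ### The heat part and the decaying part of a trajectory -/

section Parts

variable {c T : ℝ} {a : EuclideanSpace ℝ ι → ι → ℂ}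

/-- The heat factor at clamped time is at most `1` (`c ≥ 0`). [folklore] -/
theorem heat_clamp_le_one (hc : 0 ≤ c) (T t : ℝ) (ξ : EuclideanSpace ℝ ι) :
    heat c ξ (clamp T t) ≤ 1 :=
  heat_le_one hc (clamp_nonneg T t) ξ

/-- Components of the heat part: `(heat • a ξ) j = heat * a ξ j`. [folklore] -/
theorem heat_smul_apply (c : ℝ) (ξ : EuclideanSpace ℝ ι) (τ : ℝ) (a : EuclideanSpace ℝ ι → ι → ℂ)
    (j : ι) : (heat c ξ τ • a ξ) j = (heat c ξ τ : ℂ) * a ξ j := by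
  rw [Pi.smul_apply, Complex.real_smul]

/-- The heat part `η ↦ heat c η (clamp T s) • a η` is measurable when `a` is. [folklore] -/
theorem aestronglyMeasurable_heat_smul (ha : AEStronglyMeasurable a volume) (s : ℝ) :
    AEStronglyMeasurable (fun η : EuclideanSpace ℝ ι => heat c η (clamp T s) • a η) volume :=
  (continuous_heat_comp c continuous_id continuous_const).aestronglyMeasurable.smul ha

/-- Pointwise domination of the heat part by the datum: `‖heat • a η j‖ₑ ≤ ‖a η j‖ₑ`
(`c ≥ 0`). [folklore] -/
theorem enorm_heat_smul_apply_le (hc : 0 ≤ c) (s : ℝ) (η : EuclideanSpace ℝ ι) (j : ι) :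
    ‖(heat c η (clamp T s) • a η) j‖ₑ ≤ ‖a η j‖ₑ := by
  rw [heat_smul_apply, enorm_mul]
  calc ‖(heat c η (clamp T s) : ℂ)‖ₑ * ‖a η j‖ₑ ≤ 1 * ‖a η j‖ₑ := by
        gcongr
        rw [← ofReal_norm, Complex.norm_real, Real.norm_of_nonneg (heat_nonneg c η _),
          ← ENNReal.ofReal_one]
        exact ENNReal.ofReal_le_ofReal (heat_clamp_le_one hc T s η)
    _ = ‖a η j‖ₑ := one_mul _

/-- **`L²`-continuity in time of the heat part**, componentwise: for `c ≥ 0` and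
`∫ |a_j|² < ∞`, `s ↦ heat(clamp s) a_j` is continuous in `L²_ξ` (dominated convergence,
domination by `|a_j|`). [folklore] -/
theorem tendsto_eLpNorm_heat_sub (hc : 0 ≤ c) (ha : AEStronglyMeasurable a volume) (j : ι)
    (haj : ∫⁻ η, ‖a η j‖ₑ ^ 2 < ⊤) (s₀ : ℝ) :
    Tendsto (fun s => eLpNorm ((fun η => (heat c η (clamp T s) • a η) j) -
      (fun η => (heat c η (clamp T s₀) • a η) j)) 2 volume) (𝓝 s₀) (𝓝 0) :=
  tendsto_eLpNorm_sub_of_dominated (G := fun s η => (heat c η (clamp T s) • a η) j)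
    (fun s => aesm_apply (aestronglyMeasurable_heat_smul ha s) j) (fun η => ‖a η j‖ₑ)
    (fun s η => enorm_heat_smul_apply_le hc s η j) haj.ne
    (fun η => by
      simp only [heat_smul_apply]
      exact (Complex.continuous_ofReal.comp (continuous_heat_comp c continuous_const
        (continuous_clamp T))).mul continuous_const) s₀

/-- The heat part has square-integrable components. [folklore] -/
theorem memLp_heat_smul_apply (hc : 0 ≤ c) (ha : AEStronglyMeasurable a volume) (j : ι)
    (haj : ∫⁻ η, ‖a η j‖ₑ ^ 2 < ⊤) (s : ℝ) :
    MemLp (fun η => (heat c η (clamp T s) • a η) j) 2 volume := by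
  refine ⟨aesm_apply (aestronglyMeasurable_heat_smul ha s) j, ?_⟩
  rw [← lintegral_enorm_sq_rpow_half_eq_eLpNorm]
  refine ENNReal.rpow_lt_top_of_nonneg (by norm_num) (ne_of_lt (lt_of_le_of_lt ?_ haj))
  exact lintegral_mono fun η => pow_le_pow_left' (enorm_heat_smul_apply_le hc s η j) 2

variable {K : ℕ} {B : ℝ} {D : ℝ → EuclideanSpace ℝ ι → ι → ℂ}

/-- The `ℝ≥0∞` form of a pointwise decay bound: `‖f ξ‖ₑ ≤ ofReal B · (ofReal w^K)⁻¹`. [folklore] -/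
theorem HasDecay.enorm_le {F : Type*} [NormedAddCommGroup F] {f : EuclideanSpace ℝ ι → F}
    (hf : HasDecay K B f) (ξ : EuclideanSpace ℝ ι) :
    ‖f ξ‖ₑ ≤ ENNReal.ofReal B * (ENNReal.ofReal ((1 + ‖ξ‖) ^ K))⁻¹ := by
  have hpos : (0 : ℝ) < (1 + ‖ξ‖) ^ K := by positivity
  rw [← ofReal_norm, ← ENNReal.ofReal_inv_of_pos hpos, ← ENNReal.ofReal_mul hf.nonneg]
  exact ENNReal.ofReal_le_ofReal (hf ξ)

/-- The square of the decay profile `B (1 + ‖ξ‖)^{-K}` has finite integral for `K > dim/2`.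
[folklore] -/
theorem lintegral_decayProfile_sq_lt_top (hK : Module.finrank ℝ (EuclideanSpace ℝ ι) < 2 * K)
    (B : ℝ) :
    ∫⁻ ξ : EuclideanSpace ℝ ι, (ENNReal.ofReal B * (ENNReal.ofReal ((1 + ‖ξ‖) ^ K))⁻¹) ^ 2 < ⊤ := by
  calc ∫⁻ ξ : EuclideanSpace ℝ ι, (ENNReal.ofReal B * (ENNReal.ofReal ((1 + ‖ξ‖) ^ K))⁻¹) ^ 2
      = ENNReal.ofReal B ^ 2 * ∫⁻ ξ : EuclideanSpace ℝ ι, (ENNReal.ofReal ((1 + ‖ξ‖) ^ K))⁻¹ ^ 2 := by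
        rw [← lintegral_const_mul' _ _ (by simp)]
        exact lintegral_congr fun ξ => by rw [mul_pow]
    _ < ⊤ := ENNReal.mul_lt_top (by simp) (lintegral_weight_inv_sq_lt_top hK)

/-- **A pointwise decaying function of order `K > dim/2` is square integrable** (the square of
the weight `(1 + ‖ξ‖)^{-K}` is integrable). Sharper in the order than the tree's
`memLp_two_of_hasDecay` (`K > dim`). [folklore] -/
theorem lintegral_enorm_sq_lt_top_of_hasDecay {F : Type*} [NormedAddCommGroup F]
    {f : EuclideanSpace ℝ ι → F} (hK : Module.finrank ℝ (EuclideanSpace ℝ ι) < 2 * K)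
    (hf : HasDecay K B f) : ∫⁻ ξ, ‖f ξ‖ₑ ^ 2 < ⊤ :=
  lt_of_le_of_lt (lintegral_mono fun ξ => pow_le_pow_left' (hf.enorm_le ξ) 2)
    (lintegral_decayProfile_sq_lt_top hK B)

/-- `L²` membership from pointwise decay of order `K > dim/2`. [folklore] -/
theorem memLp_two_of_hasDecay_half {f : EuclideanSpace ℝ ι → ℂ}
    (hK : Module.finrank ℝ (EuclideanSpace ℝ ι) < 2 * K) (hf : HasDecay K B f)
    (hfm : AEStronglyMeasurable f volume) : MemLp f 2 volume := by
  refine ⟨hfm, ?_⟩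
  rw [← lintegral_enorm_sq_rpow_half_eq_eLpNorm]
  exact ENNReal.rpow_lt_top_of_nonneg (by norm_num) (lintegral_enorm_sq_lt_top_of_hasDecay hK hf).ne

/-- **`L²`-continuity in time of a jointly continuous trajectory with uniform decay** of order
`K > dim/2`, componentwise (dominated convergence, domination by `B (1 + ‖ξ‖)^{-K}`).
[folklore] -/
theorem tendsto_eLpNorm_sub_of_hasDecay (hK : Module.finrank ℝ (EuclideanSpace ℝ ι) < 2 * K)
    (hDc : Continuous (uncurry D)) (hD : ∀ t, HasDecay K B (D t)) (j : ι) (s₀ : ℝ) :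
    Tendsto (fun s => eLpNorm ((D s · j) - (D s₀ · j)) 2 volume) (𝓝 s₀) (𝓝 0) := by
  have hslice : ∀ s, Continuous (D s) := fun s => hDc.uncurry_left s
  refine tendsto_eLpNorm_sub_of_dominated (G := fun s η => D s η j)
    (fun s => aesm_apply (hslice s).aestronglyMeasurable j)
    (fun η => ENNReal.ofReal B * (ENNReal.ofReal ((1 + ‖η‖) ^ K))⁻¹)
    (fun s η => ((hD s).apply j).enorm_le η) (lintegral_decayProfile_sq_lt_top hK B).ne
    (fun η => ?_) s₀
  have : (fun s => D s η j) = (fun z : ι → ℂ => z j) ∘ uncurry D ∘ fun s => (s, η) := rfl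
  rw [this]
  exact (continuous_apply j).comp (hDc.comp (by fun_prop))

end Parts

/-! ### The real majorant family and joint continuity of the nonlinearity -/

section Nonlin

variable [DecidableEq ι]
variable {v w : ℝ → EuclideanSpace ℝ ι → ι → ℂ}

omit [DecidableEq ι] in
/-- Pointwise: `|∑ⱼ ‖aⱼ‖ - ∑ⱼ ‖bⱼ‖| ≤ ∑ⱼ ‖aⱼ - bⱼ‖`. [folklore] -/
theorem abs_sum_norm_sub_sum_norm_le (x y : ι → ℂ) :
    |∑ j, ‖x j‖ - ∑ j, ‖y j‖| ≤ ∑ j, ‖x j - y j‖ := by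
  rw [← Finset.sum_sub_distrib]
  refine (Finset.abs_sum_le_sum_abs _ _).trans (Finset.sum_le_sum fun j _ => ?_)
  exact abs_norm_sub_norm_le (x j) (y j)

omit [DecidableEq ι] in
/-- The real majorant `η ↦ (∑ⱼ ‖v s η j‖ : ℂ)` is measurable. [folklore] -/
theorem aestronglyMeasurable_majorantC {u : EuclideanSpace ℝ ι → ι → ℂ}
    (hu : AEStronglyMeasurable u volume) :
    AEStronglyMeasurable (fun η => ((∑ j, ‖u η j‖ : ℝ) : ℂ)) volume :=
  Complex.continuous_ofReal.comp_aestronglyMeasurable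
    (Finset.aestronglyMeasurable_fun_sum _ fun j _ => (aesm_apply hu j).norm)

omit [DecidableEq ι] in
/-- The `L²` norm of the real majorant is at most the sum of the component norms. [folklore] -/
theorem eLpNorm_majorantC_le {u : EuclideanSpace ℝ ι → ι → ℂ} (hu : AEStronglyMeasurable u volume) :
    eLpNorm (fun η => ((∑ j, ‖u η j‖ : ℝ) : ℂ)) 2 volume ≤ ∑ j, eLpNorm (u · j) 2 volume := by
  calc eLpNorm (fun η => ((∑ j, ‖u η j‖ : ℝ) : ℂ)) 2 volume
      = eLpNorm (fun η => ∑ j, ‖u η j‖) 2 volume := by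
        refine eLpNorm_congr_norm_ae (Eventually.of_forall fun η => ?_)
        rw [Complex.norm_real]
    _ = eLpNorm (∑ j, fun η => ‖u η j‖) 2 volume := by
        congr 1; funext η; simp [Finset.sum_apply]
    _ ≤ ∑ j, eLpNorm (fun η => ‖u η j‖) 2 volume :=
        eLpNorm_sum_le (fun j _ => (aesm_apply hu j).norm) one_le_two
    _ = ∑ j, eLpNorm (u · j) 2 volume := Finset.sum_congr rfl fun j _ => eLpNorm_norm _

omit [DecidableEq ι] in
/-- The real majorant of a field with square-integrable components is in `L²`. [folklore] -/
theorem memLp_majorantC {u : EuclideanSpace ℝ ι → ι → ℂ} (hu : AEStronglyMeasurable u volume)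
    (h2 : ∀ j, MemLp (u · j) 2 volume) : MemLp (fun η => ((∑ j, ‖u η j‖ : ℝ) : ℂ)) 2 volume :=
  ⟨aestronglyMeasurable_majorantC hu, (eLpNorm_majorantC_le hu).trans_lt
    (ENNReal.sum_lt_top.2 fun j _ => (h2 j).eLpNorm_lt_top)⟩

omit [DecidableEq ι] in
/-- **The majorant convolution is the norm of the convolution of the real majorants**:
`((∑ⱼ‖uⱼ‖ₑ) ⋆ₗ (∑ⱼ‖u'ⱼ‖ₑ))(ξ) = ‖(M ⋆ M')(ξ)‖ₑ`, `M = (∑ⱼ ‖u ·j‖ : ℂ)`, for fields with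
square-integrable components (the integrand is a non-negative real, integrable by
Cauchy–Schwarz). This converts majorant estimates into statements about `fconv`, to which
Plancherel and the joint-continuity lemmas apply. [folklore] -/
theorem lconv_majorant_eq_enorm_fconv {u u' : EuclideanSpace ℝ ι → ι → ℂ}
    (hu : AEStronglyMeasurable u volume) (hu' : AEStronglyMeasurable u' volume)
    (h2 : ∀ j, MemLp (u · j) 2 volume) (h2' : ∀ j, MemLp (u' · j) 2 volume)
    (ξ : EuclideanSpace ℝ ι) :
    ((fun η => ∑ j, ‖u η j‖ₑ) ⋆ₗ (fun η => ∑ j, ‖u' η j‖ₑ)) ξ =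
      ‖fconv (fun η => ((∑ j, ‖u η j‖ : ℝ) : ℂ)) (fun η => ((∑ j, ‖u' η j‖ : ℝ) : ℂ)) ξ‖ₑ := by
  set M : EuclideanSpace ℝ ι → ℂ := fun η => ((∑ j, ‖u η j‖ : ℝ) : ℂ) with hM
  set M' : EuclideanSpace ℝ ι → ℂ := fun η => ((∑ j, ‖u' η j‖ : ℝ) : ℂ) with hM'
  have hint : Integrable (fun η => M η * M' (ξ - η)) volume :=
    integrable_fconv_integrand (memLp_majorantC hu h2) (memLp_majorantC hu' h2') ξ
  have hreal : ∀ η, M η * M' (ξ - η) = (((∑ j, ‖u η j‖) * ∑ j, ‖u' (ξ - η) j‖ : ℝ) : ℂ) :=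
    fun η => by rw [hM, hM']; push_cast; ring
  have hnn : ∀ η, 0 ≤ (∑ j, ‖u η j‖) * ∑ j, ‖u' (ξ - η) j‖ := fun η =>
    mul_nonneg (Finset.sum_nonneg fun j _ => norm_nonneg _) (Finset.sum_nonneg fun j _ => norm_nonneg _)
  have hintR : Integrable (fun η => (∑ j, ‖u η j‖) * ∑ j, ‖u' (ξ - η) j‖) volume := by
    refine hint.norm.congr (Eventually.of_forall fun η => ?_)
    change ‖M η * M' (ξ - η)‖ = _
    rw [hreal, Complex.norm_real, Real.norm_eq_abs, abs_of_nonneg (hnn η)]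
  rw [fconv_apply, show (fun η => M η * M' (ξ - η)) =
      fun η => (((∑ j, ‖u η j‖) * ∑ j, ‖u' (ξ - η) j‖ : ℝ) : ℂ) from funext hreal,
    integral_complex_ofReal, ← ofReal_norm, Complex.norm_real, Real.norm_eq_abs,
    abs_of_nonneg (integral_nonneg fun η => hnn η),
    ofReal_integral_eq_lintegral_ofReal hintR (Eventually.of_forall fun η => hnn η), lconv_apply]
  refine lintegral_congr fun η => ?_
  rw [ENNReal.ofReal_mul (Finset.sum_nonneg fun j _ => norm_nonneg _),
    ENNReal.ofReal_sum_of_nonneg (fun j _ => norm_nonneg _),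
    ENNReal.ofReal_sum_of_nonneg (fun j _ => norm_nonneg _)]
  simp only [ofReal_norm]

omit [DecidableEq ι] in
/-- **`L²`-continuity of the real majorant family** from that of the components:
`‖M s - M s₀‖₂ ≤ ∑ⱼ ‖v s ·j - v s₀ ·j‖₂ → 0`. [folklore] -/
theorem tendsto_eLpNorm_majorantC_sub (hvm : ∀ s, AEStronglyMeasurable (v s) volume) {s₀ : ℝ}
    (hvc : ∀ j, Tendsto (fun s => eLpNorm ((v s · j) - (v s₀ · j)) 2 volume) (𝓝 s₀) (𝓝 0)) :
    Tendsto (fun s => eLpNorm ((fun η => ((∑ j, ‖v s η j‖ : ℝ) : ℂ)) -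
      (fun η => ((∑ j, ‖v s₀ η j‖ : ℝ) : ℂ))) 2 volume) (𝓝 s₀) (𝓝 0) := by
  have hsum : Tendsto (fun s => ∑ j, eLpNorm ((v s · j) - (v s₀ · j)) 2 volume) (𝓝 s₀) (𝓝 0) := by
    have := tendsto_finsetSum Finset.univ fun j _ => hvc j
    simpa using this
  refine tendsto_of_tendsto_of_tendsto_of_le_of_le tendsto_const_nhds hsum (fun s => zero_le)
    fun s => ?_
  calc eLpNorm ((fun η => ((∑ j, ‖v s η j‖ : ℝ) : ℂ)) - (fun η => ((∑ j, ‖v s₀ η j‖ : ℝ) : ℂ))) 2 volume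
      ≤ eLpNorm (fun η => ((∑ j, ‖(v s - v s₀) η j‖ : ℝ) : ℂ)) 2 volume := by
        refine eLpNorm_mono fun η => ?_
        simp only [Pi.sub_apply, ← Complex.ofReal_sub, Complex.norm_real, Real.norm_eq_abs]
        rw [abs_of_nonneg (Finset.sum_nonneg fun j _ => norm_nonneg _)]
        exact abs_sum_norm_sub_sum_norm_le (v s η) (v s₀ η)
    _ ≤ ∑ j, eLpNorm ((v s - v s₀) · j) 2 volume := eLpNorm_majorantC_le ((hvm s).sub (hvm s₀))
    _ = ∑ j, eLpNorm ((v s · j) - (v s₀ · j)) 2 volume := by rfl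

omit [DecidableEq ι] in
/-- Joint continuity of one component convolution `(s, ξ) ↦ (v s ·j ⋆ w s ·k)(ξ)` along
`L²`-continuous trajectories (`continuous_fconv_family`). [folklore] -/
theorem continuous_fconv_apply_of_tendsto
    (hv : ∀ s j, MemLp (v s · j) 2 volume) (hw : ∀ s j, MemLp (w s · j) 2 volume)
    (hvc : ∀ j s₀, Tendsto (fun s => eLpNorm ((v s · j) - (v s₀ · j)) 2 volume) (𝓝 s₀) (𝓝 0))
    (hwc : ∀ j s₀, Tendsto (fun s => eLpNorm ((w s · j) - (w s₀ · j)) 2 volume) (𝓝 s₀) (𝓝 0))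
    (j k : ι) :
    Continuous fun p : ℝ × EuclideanSpace ℝ ι => fconv (v p.1 · j) (w p.1 · k) p.2 :=
  continuous_fconv_family (X := ℝ) (F := fun s => (v s · j)) (G := fun s => (w s · k))
    (fun s => hv s j) (fun s => hw s k) (hvc j) (hwc k)

/-- **Joint continuity of the nonlinearity along `L²`-continuous trajectories**: if the
components of `v s`, `w s` are square integrable and continuous in `L²_ξ` as functions of `s`,
then `(s, ξ) ↦ N(v s, w s)(ξ)` is continuous on `ℝ × E` (componentwise
`continuous_fconv_family` and continuity of the symbol). [folklore] -/
theorem continuous_nonlin_of_tendsto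
    (hv : ∀ s j, MemLp (v s · j) 2 volume) (hw : ∀ s j, MemLp (w s · j) 2 volume)
    (hvc : ∀ j s₀, Tendsto (fun s => eLpNorm ((v s · j) - (v s₀ · j)) 2 volume) (𝓝 s₀) (𝓝 0))
    (hwc : ∀ j s₀, Tendsto (fun s => eLpNorm ((w s · j) - (w s₀ · j)) 2 volume) (𝓝 s₀) (𝓝 0)) :
    Continuous fun p : ℝ × EuclideanSpace ℝ ι => nonlin (v p.1) (w p.1) p.2 := by
  apply continuous_pi fun l => ?_
  have hterm : ∀ j k : ι, Continuous fun p : ℝ × EuclideanSpace ℝ ι =>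
      (lerayDerivSymbol j k l p.2 : ℂ) * fconv (v p.1 · j) (w p.1 · k) p.2 := fun j k =>
    (Complex.continuous_ofReal.comp ((continuous_lerayDerivSymbol j k l).comp
      continuous_snd)).mul (continuous_fconv_apply_of_tendsto hv hw hvc hwc j k)
  have h : Continuous fun p : ℝ × EuclideanSpace ℝ ι => -(2 * π * Complex.I) *
      ∑ j, ∑ k, (lerayDerivSymbol j k l p.2 : ℂ) * fconv (v p.1 · j) (w p.1 · k) p.2 :=
    continuous_const.mul (continuous_finsetSum _ fun j _ => continuous_finsetSum _ fun k _ =>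
      hterm j k)
  exact h.congr fun p => by rw [nonlin_apply]

/-- Continuity in time of the nonlinearity at a fixed frequency. [folklore] -/
theorem continuous_nonlin_time_of_tendsto
    (hv : ∀ s j, MemLp (v s · j) 2 volume) (hw : ∀ s j, MemLp (w s · j) 2 volume)
    (hvc : ∀ j s₀, Tendsto (fun s => eLpNorm ((v s · j) - (v s₀ · j)) 2 volume) (𝓝 s₀) (𝓝 0))
    (hwc : ∀ j s₀, Tendsto (fun s => eLpNorm ((w s · j) - (w s₀ · j)) 2 volume) (𝓝 s₀) (𝓝 0))
    (ξ : EuclideanSpace ℝ ι) : Continuous fun s : ℝ => nonlin (v s) (w s) ξ :=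
  (continuous_nonlin_of_tendsto hv hw hvc hwc).comp₂ continuous_id continuous_const

omit [DecidableEq ι] in
/-- Continuity in time of the pressure symbol at a fixed frequency (the multiplier
`ξⱼξₖ/‖ξ‖²` is discontinuous at `ξ = 0`, so only time-continuity is asserted). [folklore] -/
theorem continuous_presSymbol_time_of_tendsto
    (hv : ∀ s j, MemLp (v s · j) 2 volume) (hw : ∀ s j, MemLp (w s · j) 2 volume)
    (hvc : ∀ j s₀, Tendsto (fun s => eLpNorm ((v s · j) - (v s₀ · j)) 2 volume) (𝓝 s₀) (𝓝 0))
    (hwc : ∀ j s₀, Tendsto (fun s => eLpNorm ((w s · j) - (w s₀ · j)) 2 volume) (𝓝 s₀) (𝓝 0))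
    (ξ : EuclideanSpace ℝ ι) : Continuous fun s : ℝ => presSymbol (v s) (w s) ξ := by
  have hterm : ∀ j k : ι, Continuous fun s : ℝ =>
      ((ξ j * ξ k / ‖ξ‖ ^ 2 : ℝ) : ℂ) * fconv (v s · j) (w s · k) ξ := fun j k =>
    continuous_const.mul ((continuous_fconv_apply_of_tendsto hv hw hvc hwc j k).comp₂
      continuous_id continuous_const)
  have h : Continuous fun s : ℝ => -∑ j, ∑ k, ((ξ j * ξ k / ‖ξ‖ ^ 2 : ℝ) : ℂ) *
      fconv (v s · j) (w s · k) ξ :=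
    (continuous_finsetSum _ fun j _ => continuous_finsetSum _ fun k _ => hterm j k).neg
  exact h.congr fun s => by rw [presSymbol]

omit [DecidableEq ι] in
/-- **Joint continuity of the real majorant convolution** `(s, ξ) ↦ (M s ⋆ M s)(ξ)`,
`M s = (∑ⱼ ‖v s ·j‖ : ℂ)`, along an `L²`-continuous trajectory. [folklore] -/
theorem continuous_fconv_majorantC_of_tendsto (hvm : ∀ s, AEStronglyMeasurable (v s) volume)
    (hv : ∀ s j, MemLp (v s · j) 2 volume)
    (hvc : ∀ j s₀, Tendsto (fun s => eLpNorm ((v s · j) - (v s₀ · j)) 2 volume) (𝓝 s₀) (𝓝 0)) :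
    Continuous fun p : ℝ × EuclideanSpace ℝ ι =>
      fconv (fun η => ((∑ j, ‖v p.1 η j‖ : ℝ) : ℂ)) (fun η => ((∑ j, ‖v p.1 η j‖ : ℝ) : ℂ)) p.2 :=
  continuous_fconv_family (X := ℝ) (F := fun s η => ((∑ j, ‖v s η j‖ : ℝ) : ℂ))
    (G := fun s η => ((∑ j, ‖v s η j‖ : ℝ) : ℂ)) (fun s => memLp_majorantC (hvm s) (hv s))
    (fun s => memLp_majorantC (hvm s) (hv s))
    (fun s₀ => tendsto_eLpNorm_majorantC_sub hvm (fun j => hvc j s₀))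
    (fun s₀ => tendsto_eLpNorm_majorantC_sub hvm (fun j => hvc j s₀))

/-! ### Continuity of the Duhamel integral -/

variable {c T : ℝ}

/-- The Duhamel integrand `heat c ξ (clamp T t - s) • N(v s, v s)(ξ)` is jointly continuous in
`((t, ξ), s)` along an `L²`-continuous trajectory. [folklore] -/
theorem continuous_duhamel_integrand_of_tendsto
    (hv : ∀ s j, MemLp (v s · j) 2 volume)
    (hvc : ∀ j s₀, Tendsto (fun s => eLpNorm ((v s · j) - (v s₀ · j)) 2 volume) (𝓝 s₀) (𝓝 0)) :
    Continuous fun p : (ℝ × EuclideanSpace ℝ ι) × ℝ =>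
      heat c p.1.2 (clamp T p.1.1 - p.2) • nonlin (v p.2) (v p.2) p.1.2 := by
  have h1 : Continuous fun p : (ℝ × EuclideanSpace ℝ ι) × ℝ => heat c p.1.2 (clamp T p.1.1 - p.2) :=
    continuous_heat_comp c (by fun_prop) (by have := continuous_clamp T; fun_prop)
  have h2 : Continuous fun p : (ℝ × EuclideanSpace ℝ ι) × ℝ => nonlin (v p.2) (v p.2) p.1.2 :=
    (continuous_nonlin_of_tendsto hv hv hvc hvc).comp₂ continuous_snd
      (continuous_snd.comp continuous_fst)
  exact h1.smul h2

/-- **Joint continuity of the Duhamel integral** `(t, ξ) ↦ duhamelIntegral c T v t ξ` along an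
`L²`-continuous trajectory (parametric interval integral of a continuous integrand with the
continuous upper limit `clamp T t`). [folklore] -/
theorem continuous_duhamelIntegral_of_tendsto
    (hv : ∀ s j, MemLp (v s · j) 2 volume)
    (hvc : ∀ j s₀, Tendsto (fun s => eLpNorm ((v s · j) - (v s₀ · j)) 2 volume) (𝓝 s₀) (𝓝 0)) :
    Continuous (uncurry (duhamelIntegral c T v)) := by
  have h : Continuous fun p : ℝ × EuclideanSpace ℝ ι =>
      ∫ s in (0 : ℝ)..clamp T p.1, heat c p.2 (clamp T p.1 - s) • nonlin (v s) (v s) p.2 :=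
    intervalIntegral.continuous_parametric_intervalIntegral_of_continuous (a₀ := 0)
      (continuous_duhamel_integrand_of_tendsto hv hvc) ((continuous_clamp T).comp continuous_fst)
  have : uncurry (duhamelIntegral c T v) = fun p : ℝ × EuclideanSpace ℝ ι =>
      ∫ s in (0 : ℝ)..clamp T p.1, heat c p.2 (clamp T p.1 - s) • nonlin (v s) (v s) p.2 := by
    funext p; rfl
  rw [this]
  exact h

/-- Continuity in `s` of the Duhamel integrand at fixed `(τ, ξ)`, hence interval integrability.
[folklore] -/
theorem continuous_duhamel_integrand_time_of_tendsto
    (hv : ∀ s j, MemLp (v s · j) 2 volume)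
    (hvc : ∀ j s₀, Tendsto (fun s => eLpNorm ((v s · j) - (v s₀ · j)) 2 volume) (𝓝 s₀) (𝓝 0))
    (τ : ℝ) (ξ : EuclideanSpace ℝ ι) :
    Continuous fun s : ℝ => heat c ξ (τ - s) • nonlin (v s) (v s) ξ :=
  (continuous_heat_comp c continuous_const (continuous_const.sub continuous_id)).smul
    (continuous_nonlin_time_of_tendsto hv hv hvc hvc ξ)

/-- Components of the Duhamel integral along an `L²`-continuous trajectory:
`(duhamelIntegral c T v t ξ) l = ∫₀^{clamp t} heat (clamp t - s) N(v s, v s)(ξ)_l ds`. [folklore] -/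
theorem duhamelIntegral_apply_of_tendsto
    (hv : ∀ s j, MemLp (v s · j) 2 volume)
    (hvc : ∀ j s₀, Tendsto (fun s => eLpNorm ((v s · j) - (v s₀ · j)) 2 volume) (𝓝 s₀) (𝓝 0))
    (t : ℝ) (ξ : EuclideanSpace ℝ ι) (l : ι) :
    duhamelIntegral c T v t ξ l =
      ∫ s in (0 : ℝ)..clamp T t, heat c ξ (clamp T t - s) * nonlin (v s) (v s) ξ l := by
  have hint : IntervalIntegrable (fun s : ℝ => heat c ξ (clamp T t - s) • nonlin (v s) (v s) ξ)
      volume 0 (clamp T t) :=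
    (continuous_duhamel_integrand_time_of_tendsto hv hvc (clamp T t) ξ).intervalIntegrable _ _
  have h := ((ContinuousLinearMap.proj (R := ℝ) (φ := fun _ : ι => ℂ) l).intervalIntegral_comp_comm
    hint)
  simp only [ContinuousLinearMap.proj_apply, Pi.smul_apply, Complex.real_smul] at h
  rw [duhamelIntegral, ← h]

end Nonlin

end Literature.Analysis.FluidPDE.FourierNS

end
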